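import Summits.AtomisticToContinuum.HydrodynamicLimit.Theorems.CollisionIsometryCLTMacroClosureStubClausiusCoreB
import Summits.AtomisticToContinuum.HydrodynamicLimit.Theorems.CollisionIsometryCLTMacroClosureStubClausiusIdentify
import Summits.AtomisticToContinuum.HydrodynamicLimit.Theorems.CollisionIsometryCLTMacroClosureStubThermoEos
import Summits.AtomisticToContinuum.HydrodynamicLimit.Theorems.CollisionIsometryCLTCollisionalTransferLocalityCompressibilityBound
import HarnessLib

/-!
# Stub `stub_clausius` of the line `IdeatorTwoGen1Sketch` (crux `MacroClosure`, stmt-14870), part 7: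
# limits — Ruelle continuity of `f_ex`, the continuum telescope, the good-event functional in mean,
# the tilt parameter

Support file (`--supports stmt-AtomisticToContinuum-14870`) for the registered stub
`Barycentric.stub_clausius`; it lands the registered sub-goal `stub_clausius_goodFunctional`.

* `Clausius.continuousOn_hsExcessFreeEnergy` — the open item `HsFreeEnergyConvex` (stmt-9526, Ruelle
  convexity up to packing `1.1`) makes `f_ex` continuous on `(0, 1.1)` (the segment function
  `r ↦ (5/2) r log r + r f_ex(r)` of `HemisphereAffineSlaving.convexOn_segment` is convex on an open interval);
* `Clausius.telescope_continuum` — `∫ η_σ(U₀) = ∫ h_σ(U₀|U_c) + η_σ(U_c) + Λ_c((1, ∫ρ₀u, ∫E) − U_c)` for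
  continuous data with packing `≤ 1` and unit mass;
* `Clausius.tendsto_goodFunctional` — `E[𝟙_{G_N}(η_σ(U_c) + Λ_c((1,p,e) − U_c))] → η_σ(U_c) +
  Λ_c((1,P₀,E₀) − U_c)` from `p → P₀`, `e → E₀` in probability, the uniform second moment
  `stub_clausius_moment` and `Clausius.tendsto_integral_indicator`;
* `Clausius.tilt_bounds`, `Clausius.eventually_kernel_lt` — elementary.
-/

noncomputable section

open MeasureTheory Filter Set Topology InformationTheory
open scoped ENNReal ContDiff

namespace Summit.AtomisticToContinuum.HydrodynamicLimit.Theorems.MacroClosureLine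

open Literature.MathematicalPhysics.KineticTheory Literature.Analysis.FluidPDE
open Literature.Analysis.FunctionSpaces
open Summit.AtomisticToContinuum.HydrodynamicLimit.Theses

namespace Barycentric

namespace Clausius

/-! ## Continuity of the excess free energy from Ruelle convexity -/

/-- **Ruelle convexity makes `f_ex` continuous on `(0, 1.1)`**: the segment function
`r ↦ (5/2) r log r + r f_ex(r)` is convex on the open interval (`HemisphereAffineSlaving.convexOn_segment`
at `σ = 1`), hence continuous, and `f_ex(r) = (g(r) − (5/2) r log r)/r`. [folklore] -/
theorem continuousOn_hsExcessFreeEnergy (hH : StiffCollisionalRelaxation.HsFreeEnergyConvex) :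
    ContinuousOn hsExcessFreeEnergy (Ioo 0 (11 / 10)) := by
  have hconv := HemisphereAffineSlaving.convexOn_segment hH one_pos
  have hI : Ioo (0 : ℝ) (11 / 10 * (1 / (1 : ℝ) ^ 3)) = Ioo 0 (11 / 10) := by norm_num
  rw [hI] at hconv
  simp only [one_pow, mul_one] at hconv
  have hg : ContinuousOn (fun r : ℝ => 5 / 2 * (r * Real.log r) + r * hsExcessFreeEnergy r) (Ioo 0 (11 / 10)) :=
    hconv.continuousOn isOpen_Ioo
  have hlog : ContinuousOn (fun r : ℝ => 5 / 2 * (r * Real.log r)) (Ioo 0 (11 / 10)) :=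
    continuousOn_const.mul (continuousOn_id.mul (Real.continuousOn_log.mono fun r hr => hr.1.ne'))
  have hq : ContinuousOn (fun r : ℝ => (5 / 2 * (r * Real.log r) + r * hsExcessFreeEnergy r -
      5 / 2 * (r * Real.log r)) / r) (Ioo 0 (11 / 10)) :=
    (hg.sub hlog).div continuousOn_id fun r hr => hr.1.ne'
  refine hq.congr fun r hr => ?_
  have hr0 : r ≠ 0 := hr.1.ne'
  show hsExcessFreeEnergy r =
    (5 / 2 * (r * Real.log r) + r * hsExcessFreeEnergy r - 5 / 2 * (r * Real.log r)) / r
  rw [add_sub_cancel_left, mul_div_cancel_left₀ _ hr0]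

/-! ## Elementary limits -/

/-- Eventually `C (N+1)^{3γ} < c₁ (N+1)` when `3γ < 1`. [folklore] -/
theorem eventually_kernel_lt {γ C c₁ : ℝ} (hγ3 : 3 * γ < 1) (hc₁ : 0 < c₁) :
    ∀ᶠ N : ℕ in atTop, C * ((N : ℝ) + 1) ^ (3 * γ) < ((N + 1 : ℕ) : ℝ) * c₁ := by
  have hpow : Tendsto (fun N : ℕ => ((N : ℝ) + 1) ^ (1 - 3 * γ)) atTop atTop := by
    have h1 : Tendsto (fun N : ℕ => (N : ℝ) + 1) atTop atTop :=
      tendsto_natCast_atTop_atTop.atTop_add tendsto_const_nhds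
    exact (tendsto_rpow_atTop (by linarith)).comp h1
  have hev := hpow.eventually_gt_atTop (C / c₁)
  filter_upwards [hev] with N hN
  have hN0 : (0 : ℝ) < (N : ℝ) + 1 := by positivity
  have hsplit : ((N : ℝ) + 1) = ((N : ℝ) + 1) ^ (1 - 3 * γ) * ((N : ℝ) + 1) ^ (3 * γ) := by
    rw [← Real.rpow_add hN0, sub_add_cancel, Real.rpow_one]
  have hp0 : 0 < ((N : ℝ) + 1) ^ (3 * γ) := Real.rpow_pos_of_pos hN0 _
  have hlt : C < c₁ * ((N : ℝ) + 1) ^ (1 - 3 * γ) := by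
    rw [div_lt_iff₀ hc₁] at hN; linarith
  calc C * ((N : ℝ) + 1) ^ (3 * γ) < c₁ * ((N : ℝ) + 1) ^ (1 - 3 * γ) * ((N : ℝ) + 1) ^ (3 * γ) :=
        mul_lt_mul_of_pos_right hlt hp0
    _ = ((N + 1 : ℕ) : ℝ) * c₁ := by push_cast; rw [mul_assoc, ← hsplit]; ring

/-! ## The continuum telescope at `t = 0` -/

/-- **Continuum Bregman telescope**: for continuous `ρ₀ > 0`, `u`, `θ > 0` with packing `ρ₀σ³ ≤ 1`, unit mass
and `f_ex` continuous on `(0, 1.1)`: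
`∫ η_σ(U₀) = ∫ h_σ(U₀|U_c) + η_σ(U_c) + Λ_c((1, ∫ρ₀u, ∫E(ρ₀,u,θ)) − U_c)`, `U₀ = stateOf ρ₀ u θ`. [folklore] -/
theorem telescope_continuum {σ : ℝ} (hσ : 0 < σ) (hfexO : ContinuousOn hsExcessFreeEnergy (Ioo 0 (11 / 10)))
    {ρ₀ θ₁ : T3 → ℝ} {u₁ : T3 → V3} (hρc : Continuous ρ₀) (huc : Continuous u₁) (hθc : Continuous θ₁)
    (hρpos : ∀ x, 0 < ρ₀ x) (hθpos : ∀ x, 0 < θ₁ x) (hpack : ∀ x, ρ₀ x * σ ^ 3 ≤ 1) (hmass : ∫ x, ρ₀ x = 1)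
    (Uc : State) :
    ∫ x, hsEntropy σ (stateOf (ρ₀ x) (u₁ x) (θ₁ x)) =
      (∫ x, relEnt σ (stateOf (ρ₀ x) (u₁ x) (θ₁ x)) Uc) + hsEntropy σ Uc +
        fderiv ℝ (hsEntropy σ) Uc ((((1 : ℝ), ∫ x, ρ₀ x • u₁ x, ∫ x, totalEnergyDensity (ρ₀ x) (u₁ x) (θ₁ x)) :
          State) - Uc) := by
  have hσ3 : 0 < σ ^ 3 := pow_pos hσ 3
  set Λ : State →L[ℝ] ℝ := fderiv ℝ (hsEntropy σ) Uc with hΛ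
  set U0 : T3 → State := fun x => stateOf (ρ₀ x) (u₁ x) (θ₁ x) with hU0
  have hηU0c : Continuous fun x => hsEntropy σ (U0 x) := by
    have hrepr : (fun x => hsEntropy σ (U0 x)) = fun x =>
        ρ₀ x * Real.log (ρ₀ x) - 3 / 2 * ρ₀ x * Real.log (θ₁ x) + ρ₀ x * hsExcessFreeEnergy (ρ₀ x * σ ^ 3) := by
      funext x; exact hsEntropy_stateOf σ (hρpos x).ne' _ _
    rw [hrepr]
    have hfe : Continuous fun x => hsExcessFreeEnergy (ρ₀ x * σ ^ 3) :=
      hfexO.comp_continuous (hρc.mul continuous_const) fun x =>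
        ⟨mul_pos (hρpos x) hσ3, (hpack x).trans_lt (by norm_num)⟩
    exact ((hρc.mul (hρc.log fun x => (hρpos x).ne')).sub
      ((continuous_const.mul hρc).mul (hθc.log fun x => (hθpos x).ne'))).add (hρc.mul hfe)
  have hi1 : Integrable (fun x => ρ₀ x) := integrable_of_continuous_T3 hρc
  have hi2 : Integrable (fun x => ρ₀ x • u₁ x) := integrable_of_continuous_T3 (hρc.smul huc)
  have hi3 : Integrable (fun x => totalEnergyDensity (ρ₀ x) (u₁ x) (θ₁ x)) :=
    integrable_of_continuous_T3 (continuous_totalEnergyDensity_comp hρc huc hθc)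
  have hU0c : Continuous U0 := by
    simp only [hU0, stateOf]
    exact hρc.prodMk ((hρc.smul huc).prodMk (continuous_totalEnergyDensity_comp hρc huc hθc))
  have hU0int : Integrable U0 := integrable_of_continuous_T3 hU0c
  have hintU0 : ∫ x, U0 x =
      (((1 : ℝ), ∫ x, ρ₀ x • u₁ x, ∫ x, totalEnergyDensity (ρ₀ x) (u₁ x) (θ₁ x)) : State) := by
    simp only [hU0, stateOf]
    rw [integral_pair hi1 (hi2.prodMk hi3), integral_pair hi2 hi3, hmass]
  have hrelc : Continuous fun x => relEnt σ (U0 x) Uc := by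
    have : (fun x => relEnt σ (U0 x) Uc) = fun x => hsEntropy σ (U0 x) - hsEntropy σ Uc - Λ (U0 x - Uc) := rfl
    rw [this]
    exact (hηU0c.sub continuous_const).sub (Λ.continuous.comp (hU0c.sub continuous_const))
  have hrelInt : Integrable fun x => relEnt σ (U0 x) Uc := integrable_of_continuous_T3 hrelc
  have hΛint : Integrable fun x => Λ (U0 x - Uc) :=
    integrable_of_continuous_T3 (Λ.continuous.comp (hU0c.sub continuous_const))
  have hdecomp : ∀ x, hsEntropy σ (U0 x) = relEnt σ (U0 x) Uc + hsEntropy σ Uc + Λ (U0 x - Uc) := by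
    intro x
    show hsEntropy σ (U0 x) = hsEntropy σ (U0 x) - hsEntropy σ Uc - Λ (U0 x - Uc) + hsEntropy σ Uc + Λ (U0 x - Uc)
    ring
  have h12 : Integrable fun x => relEnt σ (U0 x) Uc + hsEntropy σ Uc := hrelInt.add (integrable_const _)
  have hsub : Integrable fun x => U0 x - Uc := hU0int.sub (integrable_const Uc)
  calc ∫ x, hsEntropy σ (U0 x) = ∫ x, (relEnt σ (U0 x) Uc + hsEntropy σ Uc + Λ (U0 x - Uc)) :=
        integral_congr_ae (Eventually.of_forall hdecomp)
    _ = (∫ x, relEnt σ (U0 x) Uc) + hsEntropy σ Uc + Λ ((∫ x, U0 x) - Uc) := by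
        rw [integral_add h12 hΛint, integral_add hrelInt (integrable_const _), integral_const, probReal_univ,
          one_smul, ContinuousLinearMap.integral_comp_comm Λ hsub, integral_sub hU0int (integrable_const Uc),
          integral_const, probReal_univ, one_smul]
    _ = _ := by rw [hintU0]

/-! ## The good-event functional in mean -/

/-- **The good-event functional in mean**: if `p → P₀` and `e → E₀` in probability under the local
Gibbs laws (continuous positive profiles, `σ ≤ 1/2`) and `P(G_Nᶜ) → 0` for measurable `G_N`, then
`E[𝟙_{G_N}(η_σ(U_c) + Λ_c((1,p,e) − U_c))] → η_σ(U_c) + Λ_c((1,P₀,E₀) − U_c)` (uniform second moment of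
`e`, `stub_clausius_moment`, and `Clausius.tendsto_integral_indicator`). [folklore] -/
theorem tendsto_goodFunctional {σ : ℝ} (hσ2 : σ ≤ 1 / 2) {a₀ θ₀ : T3 → ℝ} {u₀ : T3 → V3}
    (ha : Continuous a₀) (hθ : Continuous θ₀) (hu : Continuous u₀) (ha0 : ∀ x, 0 < a₀ x)
    (hθ0 : ∀ x, 0 < θ₀ x) (Φ : (N : ℕ) → Flow σ N) (Uc : State) (P₀ : V3) (E₀ : ℝ)
    (hmom : ∀ δ' : ℝ, 0 < δ' → Tendsto (fun N => localGibbsLaw σ a₀ u₀ θ₀ N (Φ N)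
        {z | δ' < ‖empiricalMomentumField z (fun _ => (1 : ℝ)) - P₀‖}) atTop (𝓝 0))
    (hen : ∀ δ' : ℝ, 0 < δ' → Tendsto (fun N => localGibbsLaw σ a₀ u₀ θ₀ N (Φ N)
        {z | δ' < |empiricalEnergyField z (fun _ => (1 : ℝ)) - E₀|}) atTop (𝓝 0))
    {G : (N : ℕ) → Set (Config (N + 1) (Fin 3) T3)} (hGm : ∀ N, MeasurableSet (G N))
    (hGc : Tendsto (fun N => localGibbsLaw σ a₀ u₀ θ₀ N (Φ N) (G N)ᶜ) atTop (𝓝 0)) :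
    Tendsto (fun N => ∫ z, (G N).indicator (fun z => hsEntropy σ Uc + fderiv ℝ (hsEntropy σ) Uc
        ((((1 : ℝ), empiricalMomentumField z (fun _ => (1 : ℝ)), empiricalEnergyField z (fun _ => (1 : ℝ))) :
          State) - Uc)) z ∂(localGibbsLaw σ a₀ u₀ θ₀ N (Φ N))) atTop
      (𝓝 (hsEntropy σ Uc + fderiv ℝ (hsEntropy σ) Uc ((((1 : ℝ), P₀, E₀) : State) - Uc))) := by
  set P : (N : ℕ) → Measure (Config (N + 1) (Fin 3) T3) := fun N => localGibbsLaw σ a₀ u₀ θ₀ N (Φ N) with hP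
  haveI hPprob : ∀ N, IsProbabilityMeasure (P N) := fun N =>
    isProbabilityMeasure_localGibbsLaw ha hθ hu ha0 hθ0 hσ2 N (Φ N)
  set Λ : State →L[ℝ] ℝ := fderiv ℝ (hsEntropy σ) Uc with hΛ
  set S : (N : ℕ) → Config (N + 1) (Fin 3) T3 → ℝ := fun N z => hsEntropy σ Uc +
    Λ ((((1 : ℝ), empiricalMomentumField z (fun _ => (1 : ℝ)), empiricalEnergyField z (fun _ => (1 : ℝ))) : State) -
      Uc) with hS
  set Sinf : ℝ := hsEntropy σ Uc + Λ ((((1 : ℝ), P₀, E₀) : State) - Uc) with hSinf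
  obtain ⟨M, hM2⟩ := sq_energy_moment (σ := σ) hσ2 ha hθ hu ha0 hθ0
  set A : ℝ := |hsEntropy σ Uc| + ‖Λ‖ * (3 / 2 + ‖Uc‖) with hA
  have hSm : ∀ N, Measurable (S N) := fun N =>
    (continuous_const.add (Λ.continuous.comp (continuous_totals.sub continuous_const))).measurable
  have hSabs : ∀ N z, |S N z| ≤ A + 2 * ‖Λ‖ * empiricalEnergyField z (fun _ => (1 : ℝ)) := fun N z =>
    abs_goodFunctional_le σ Uc z
  have hSsq : ∀ N z, S N z ^ 2 ≤ 2 * A ^ 2 + 8 * ‖Λ‖ ^ 2 * (empiricalEnergyField z fun _ => (1 : ℝ)) ^ 2 := by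
    intro N z
    have h := hSabs N z
    have h' : |S N z| ^ 2 ≤ (A + 2 * ‖Λ‖ * empiricalEnergyField z (fun _ => (1 : ℝ))) ^ 2 :=
      pow_le_pow_left₀ (abs_nonneg _) h 2
    rw [sq_abs] at h'
    nlinarith [sq_nonneg (A - 2 * ‖Λ‖ * empiricalEnergyField z (fun _ => (1 : ℝ)))]
  have hS2i : ∀ N, Integrable (fun z => S N z ^ 2) (P N) := by
    intro N
    obtain ⟨hi, -⟩ := hM2 N (Φ N)
    refine ((integrable_const (2 * A ^ 2)).add (hi.const_mul (8 * ‖Λ‖ ^ 2))).mono'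
      ((hSm N).pow_const 2).aestronglyMeasurable (ae_of_all _ fun z => ?_)
    rw [Real.norm_eq_abs, abs_of_nonneg (sq_nonneg _)]
    exact hSsq N z
  have hS2 : ∀ N, ∫ z, S N z ^ 2 ∂P N ≤ 2 * A ^ 2 + 8 * ‖Λ‖ ^ 2 * M := by
    intro N
    obtain ⟨hi, hle⟩ := hM2 N (Φ N)
    have hgi : Integrable (fun z => 2 * A ^ 2 + 8 * ‖Λ‖ ^ 2 * (empiricalEnergyField z fun _ => (1 : ℝ)) ^ 2) (P N) :=
      (integrable_const _).add (hi.const_mul _)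
    calc ∫ z, S N z ^ 2 ∂P N
        ≤ ∫ z, (2 * A ^ 2 + 8 * ‖Λ‖ ^ 2 * (empiricalEnergyField z fun _ => (1 : ℝ)) ^ 2) ∂P N :=
          integral_mono (hS2i N) hgi (hSsq N)
      _ = 2 * A ^ 2 + 8 * ‖Λ‖ ^ 2 * ∫ z, (empiricalEnergyField z fun _ => (1 : ℝ)) ^ 2 ∂P N := by
          rw [integral_add (integrable_const _) (hi.const_mul _), integral_const, smul_eq_mul, probReal_univ,
            one_mul]
          congr 1
          exact integral_const_mul _ _
      _ ≤ 2 * A ^ 2 + 8 * ‖Λ‖ ^ 2 * M := by nlinarith [hle, sq_nonneg ‖Λ‖]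
  -- convergence in probability of `S N` to `Sinf`
  have hconv : ∀ δ' : ℝ, 0 < δ' → Tendsto (fun N => P N {z | δ' < |S N z - Sinf|}) atTop (𝓝 0) := by
    intro δ' hδ'
    set L : ℝ := ‖Λ‖ + 1 with hL
    have hL0 : 0 < L := by positivity
    have hLne : L ≠ 0 := hL0.ne'
    have hη : 0 < δ' / (2 * L) := by positivity
    have hsum : Tendsto (fun N => P N {z | δ' / (2 * L) < ‖empiricalMomentumField z (fun _ => (1 : ℝ)) - P₀‖} +
        P N {z | δ' / (2 * L) < |empiricalEnergyField z (fun _ => (1 : ℝ)) - E₀|}) atTop (𝓝 0) := by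
      simpa using (hmom _ hη).add (hen _ hη)
    refine tendsto_of_tendsto_of_tendsto_of_le_of_le tendsto_const_nhds hsum (fun N => zero_le) fun N => ?_
    refine (measure_mono fun z hz => ?_).trans (measure_union_le _ _)
    simp only [mem_setOf_eq, mem_union] at hz ⊢
    by_contra hcon
    push Not at hcon
    obtain ⟨h1, h2⟩ := hcon
    have hdiff : S N z - Sinf = Λ ((((0 : ℝ), empiricalMomentumField z (fun _ => (1 : ℝ)) - P₀,
        empiricalEnergyField z (fun _ => (1 : ℝ)) - E₀)) : State) := by
      simp only [hS, hSinf]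
      rw [add_sub_add_left_eq_sub, ← map_sub, sub_sub_sub_cancel_right, Prod.mk_sub_mk, Prod.mk_sub_mk,
        sub_self]
    have hnorm : ‖((((0 : ℝ), empiricalMomentumField z (fun _ => (1 : ℝ)) - P₀,
        empiricalEnergyField z (fun _ => (1 : ℝ)) - E₀)) : State)‖ ≤ δ' / (2 * L) + δ' / (2 * L) := by
      rw [Prod.norm_mk, Prod.norm_mk]
      refine max_le (by rw [norm_zero]; positivity) (max_le (by linarith [h1, hη.le]) ?_)
      rw [Real.norm_eq_abs]; linarith [h2, hη.le]
    have hb : |S N z - Sinf| ≤ ‖Λ‖ * (δ' / (2 * L) + δ' / (2 * L)) := by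
      rw [hdiff, ← Real.norm_eq_abs]
      exact (Λ.le_opNorm _).trans (mul_le_mul_of_nonneg_left hnorm (norm_nonneg _))
    have hfin : ‖Λ‖ * (δ' / (2 * L) + δ' / (2 * L)) ≤ δ' := by
      rw [show ‖Λ‖ * (δ' / (2 * L) + δ' / (2 * L)) = δ' * (‖Λ‖ / L) by field_simp; ring]
      have : ‖Λ‖ / L ≤ 1 := by rw [div_le_one hL0, hL]; linarith
      nlinarith [hδ']
    linarith
  exact tendsto_integral_indicator P hSm hS2i hS2 hconv hGm hGc

/-! ## The tilt parameter -/

/-- The tilt `γ' = max(1/2, 1 − δ/(8(|H|+1)))` lies in `[1/2, 1)` and `|H|(1/γ' − 1) ≤ δ/4`. [folklore] -/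
theorem tilt_bounds (H δ : ℝ) (hδ : 0 < δ) :
    1 / 2 ≤ max (1 / 2) (1 - δ / (8 * (|H| + 1))) ∧ max (1 / 2) (1 - δ / (8 * (|H| + 1))) < 1 ∧
      |H| * ((max (1 / 2) (1 - δ / (8 * (|H| + 1))))⁻¹ - 1) ≤ δ / 4 := by
  set γ' : ℝ := max (1 / 2) (1 - δ / (8 * (|H| + 1))) with hγ'
  have hγ'half : 1 / 2 ≤ γ' := le_max_left _ _
  have hγ'0 : 0 < γ' := lt_of_lt_of_le (by norm_num) hγ'half
  have hpos : 0 < δ / (8 * (|H| + 1)) := by positivity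
  have hγ'1 : γ' < 1 := max_lt (by norm_num) (by linarith)
  refine ⟨hγ'half, hγ'1, ?_⟩
  have h1 : 1 - γ' ≤ δ / (8 * (|H| + 1)) := by
    have := le_max_right (1 / 2) (1 - δ / (8 * (|H| + 1)))
    rw [← hγ'] at this; linarith
  have h2 : γ'⁻¹ - 1 = (1 - γ') / γ' := by field_simp
  have h3 : (1 - γ') / γ' ≤ 2 * (1 - γ') := by
    rw [div_le_iff₀ hγ'0]
    nlinarith [mul_nonneg (sub_nonneg.2 hγ'1.le) (by linarith : (0 : ℝ) ≤ 2 * γ' - 1)]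
  have h4 : |H| * (2 * (1 - γ')) ≤ |H| * (2 * (δ / (8 * (|H| + 1)))) :=
    mul_le_mul_of_nonneg_left (by linarith) (abs_nonneg _)
  have h5 : |H| * (2 * (δ / (8 * (|H| + 1)))) ≤ δ / 4 := by
    rw [show |H| * (2 * (δ / (8 * (|H| + 1)))) = (δ / 4) * (|H| / (|H| + 1)) by field_simp; ring]
    have : |H| / (|H| + 1) ≤ 1 := by rw [div_le_one (by positivity)]; linarith
    nlinarith [hδ]
  calc |H| * (γ'⁻¹ - 1) = |H| * ((1 - γ') / γ') := by rw [h2]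
    _ ≤ |H| * (2 * (1 - γ')) := mul_le_mul_of_nonneg_left h3 (abs_nonneg _)
    _ ≤ δ / 4 := h4.trans h5

end Clausius

/-- Registered sub-goal `stub_clausius_goodFunctional` of the stub `stub_clausius`: the good-event
functional in mean (`Clausius.tendsto_goodFunctional`). [folklore] -/
theorem stub_clausius_goodFunctional : ∀ (σ : ℝ), σ ≤ 1 / 2 → ∀ (a₀ θ₀ : T3 → ℝ) (u₀ : T3 → V3), Continuous a₀ → Continuous θ₀ → Continuous u₀ → (∀ x, 0 < a₀ x) → (∀ x, 0 < θ₀ x) → ∀ (Φ : (N : ℕ) → Flow σ N) (Uc : State) (P₀ : V3) (E₀ : ℝ), (∀ δ' : ℝ, 0 < δ' → Tendsto (fun N => localGibbsLaw σ a₀ u₀ θ₀ N (Φ N) {z | δ' < ‖empiricalMomentumField z (fun _ => (1 : ℝ)) - P₀‖}) atTop (𝓝 0)) → (∀ δ' : ℝ, 0 < δ' → Tendsto (fun N => localGibbsLaw σ a₀ u₀ θ₀ N (Φ N) {z | δ' < |empiricalEnergyField z (fun _ => (1 : ℝ)) - E₀|}) atTop (𝓝 0)) → ∀ (G : (N : ℕ)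 → Set (Config (N + 1) (Fin 3) T3)), (∀ N, MeasurableSet (G N)) → Tendsto (fun N => localGibbsLaw σ a₀ u₀ θ₀ N (Φ N) (G N)ᶜ) atTop (𝓝 0) → Tendsto (fun N => ∫ z, (G N).indicator (fun z => hsEntropy σ Uc + fderiv ℝ (hsEntropy σ) Uc ((((1 : ℝ), empiricalMomentumField z (fun _ => (1 : ℝ)), empiricalEnergyField z (fun _ => (1 : ℝ))) : State) - Uc)) z ∂(localGibbsLaw σ a₀ u₀ θ₀ N (Φ N))) atTop (𝓝 (hsEntropy σ Uc + fderiv ℝ (hsEntropy σ) Uc ((((1 : ℝ), P₀, E₀) : State) - Uc))) :=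
  fun _ hσ2 _ _ _ ha hθ hu ha0 hθ0 Φ Uc P₀ E₀ hmom hen _ hGm hGc =>
    Clausius.tendsto_goodFunctional hσ2 ha hθ hu ha0 hθ0 Φ Uc P₀ E₀ hmom hen hGm hGc

end Barycentric

end Summit.AtomisticToContinuum.HydrodynamicLimit.Theorems.MacroClosureLine

end
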